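import Summits.HodgeConjecture.HodgeConjecture.Theorems.R90S3DeltaTransferRelTransport   -- ★ PART 1 (this seat, p862896): `isDeltaTransferRel_transport_iff` over ★ `Rogawski1990.LocalTransferTransport`
import Literature.NumberTheory.Rogawski1990.FinExplicitTransferFactorConjLeft   -- ★ `finExplicitDelta_conj_left_all` (brings `finExplicitDelta`, `finExplicitCollection`, `finExplicitCollection_Δ`)
import Literature.NumberTheory.Rogawski1990.FinExplicitTransferFactorConjRight  -- ★ `finExplicitDelta_conj_right_all`
import Literature.NumberTheory.Rogawski1990.EndoscopicEmbedding           -- ★ `endoEmb`, `coe_coe_endoEmb_eq`, `endoForm_localForm`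
import Literature.NumberTheory.Automorphic.TorusCharacterLocalComponents -- ★ `HeckeCharacter.semilocalComponent` (the currency's `hΦμ`)
import HarnessLib

/-!
# R90-TF · S3 wave 4 (J-S3-3), DEAL S3-p18 = BRICK G2: `Δ‴`-MATCHING OF A PAIR OF FUNCTIONS TRANSPORTS ALONG A GROUND-FIELD CHANGE
# (`Theorems/R90S3TransportDeltaTransfer.lean` — pays `stub_R90_S3_transport_deltaTransfer` BY NAME modulo G1 `stub_R90_S3_transport_delta`, taken hypothesis-first as `hΔ`)

Cell `hodgecm-mathlib`, crux H413 (`stmt-HodgeConjecture-24833`), route of record `HCCMUnconditional`; programme R90-TF, section S3 (base `R90-C12`), wave 4 «LOCAL TRANSPORT»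
(RULING S3-R12; LEAD #33 (C), #35 (D); dealer R90-C12-plan (g2) DEAL S3-p18 2026-09-04T22:5xZ → K2E4-p14 (g11); HEADBYTES R90-C12-typ1 (g3) 22:55:37Z: socket
`stub_R90_S3_transport_deltaTransfer` of `Cruxes/H413/Lines/R90_S3_LocalTransportWaveG.lean` cand 2c704fd3315d667b :122–:192, binders VERBATIM below with ONE added
hypothesis `hΔ` = socket G1's conclusion).  Lane `--supports stmt-HodgeConjecture-24833 --as helper`; THEOREMS ONLY (no definition, no instance, no notation, no `sorry`);
★-only imports (a `Theorems/` file never imports `Cruxes/…/Lines`); ns `…R90.S3`.  The Lines-side pay line (G ED. 2, typist's pen): `stub_R90_S3_transport_deltaTransfer … :=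
isLocalDeltaTransfer_transport_iff_of_delta … (fun γH γ => stub_R90_S3_transport_delta … γH γ) …`.

THE MATHEMATICS [Rogawski1990 §4.3 (4.3.1) p. 43, §14.2 p. 232; Gelbart1975 §10 pp. 154–155].  ★ `IsLocalDeltaTransfer L H′ v Δ m_H m_G f^H f` is ★ `IsDeltaTransferRel` at the
`cmDatum` carriers: for every `G`-regular `γ_H ∈ H_v`, `Φ^st_H(γ_H, f^H; m_H) = Σᶠ_{[γ]} Δ(γ_H, γ)·Φ([γ], f; m_G)`.  Along bicontinuous group isomorphisms `ψ_A : A ≃* A′`,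
`ψ_B : B ≃* B′` EVERYTHING transports (§1, generic): the stable side by ★ `stableOrbitalIntegralRel_transport` (stable conjugacy intertwined by `ψ_A` and a class function),
each class orbital integral EXACTLY by ★ `classOrbitalIntegral_transport`, the transfer factor at the chosen representatives by `conj_right` + ★ `isConj_apply_out_preClass`, and
the `finsum` over `ConjClasses B′` re-indexed along `c′ ↦ ψ_B⁻¹ c′`; so **(4.3.1) holds for the transported families, functions and an image-agreeing factor iff it holds for
the original data** (`isDeltaTransferRel_transport_iff`).  For the ground-field change `Φ : R_v ≃+* R′_{v′}` of the S3 currency (★ K2E1 row 21), with `e_H = (e₂, e₁)` and `e₃`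
acting entrywise by `Φ` (`heₙ`), the CM hypotheses of §1 hold (§2–§3): `G`-regularity is separability of the characteristic polynomial of `ι(γ_H)` and `ι(e_H γ_H) = Φ·ι(γ_H)`
entrywise (★ `coe_coe_endoEmb_eq`: the matrix `(a 0 b; 0 u 0; c 0 d)`), so it is `Φ`-invariant (Mathlib `Matrix.charpoly_map`, `Polynomial.Separable.map`); stable conjugacy in
`H_v` is componentwise `GL`-conjugacy (★ `IsStablyConj` := `IsConj` in `GL_n(R_v)`), `Φ`-invariant; and `Δ‴_{v′}(e_H γ_H, e₃ γ) = Δ‴_v(γ_H, γ)` is brick G1 (`hΔ`).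
* §1 = PART 1 ★ `Theorems/R90S3DeltaTransferRelTransport.lean` (generic `isDeltaTransferRel_transport_iff`, imported — not restated).
* §2 (generic `GL_n` over a ring isomorphism) `map_ringEquiv_symm_map`, **`isConj_map_ringEquiv_iff`**, **`isRegularElt_map_ringEquiv_iff`**.
* §3 (the socket's bytes) `coe_endoEmb_transport` (`ι` commutes with `(e_H, e₃)` on matrices), `isLocalGRegular_transport_iff`, `isLocalStablyConjH_transport_iff`,
  `isLocalStablyConjH_congr_of_isConj`, and the HEAD **`isLocalDeltaTransfer_transport_iff_of_delta`** = `stub_R90_S3_transport_deltaTransfer`'s conclusion under `hΔ`.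
HONEST LABEL: transport-of-structure bookkeeping, no print input; HC_CM is proved only modulo the 7 printed citations (2 remaining named inputs: hLiu418 = stmt-HodgeConjecture-24832,
h413 = stmt-HodgeConjecture-24833) until rung 0 closes; count-neutral helper, closes no socket by itself (G2 closes on G ED. 2's one-line pay once G1 is paid or fed).

## References
* [Rogawski1990] J. D. Rogawski, *Automorphic Representations of Unitary Groups in Three Variables*, Ann. of Math. Stud. 123 (1990), §4.3 (4.3.1) p. 43; §4.8 Case (a) p. 53
  (`ι : U(2) × U(1) → U(3)`); §14.2 (14.2.1) p. 232; §3.1 p. 19 (stable conjugacy).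
* [Gelbart1975] S. Gelbart, *Automorphic forms on adele groups*, Ann. of Math. Stud. 83 (1975), §10 pp. 154–155 (orbital integrals matched class by class along an identification).
-/

set_option autoImplicit false
-- the mandated namespace repeats the single-problem summit's segment (`HodgeConjecture.HodgeConjecture`)
set_option linter.dupNamespace false

noncomputable section

open MeasureTheory Topology IsDedekindDomain NumberField
open Literature.NumberTheory Literature.NumberTheory.Automorphic Literature.NumberTheory.Automorphic.UnitaryGroup
open Literature.NumberTheory.Rogawski1990 Literature.NumberTheory.GaloisRepresentations
open scoped Matrix MatrixGroups

namespace Summit.HodgeConjecture.HodgeConjecture.R90.S3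

/-! ## §1 Transport of (4.3.1) along a pair of bicontinuous group isomorphisms (generic) — ★ PART 1 `R90S3DeltaTransferRelTransport.isDeltaTransferRel_transport_iff`, imported -/

/-! ## §2 `GL_n` along a ring isomorphism: conjugacy and regularity are invariant (generic) -/

section GLRingEquiv

variable {R R' : Type*} [CommRing R] [CommRing R'] {n : Type*} [Fintype n] [DecidableEq n] (Φ : R ≃+* R')

/-- `GL.map Φ⁻¹ (GL.map Φ g) = g`. [cite: Rogawski1990, §3.1 p. 19] -/
theorem map_ringEquiv_symm_map (g : GL n R) :
    Matrix.GeneralLinearGroup.map (Φ.symm : R' →+* R) (Matrix.GeneralLinearGroup.map (Φ : R →+* R') g) = g :=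
  Matrix.GeneralLinearGroup.ext fun i j => by
    simp only [Matrix.GeneralLinearGroup.map_apply, RingHom.coe_coe, RingEquiv.symm_apply_apply]

/-- **Conjugacy in `GL_n` is invariant under a ring isomorphism applied entrywise.** [cite: Rogawski1990, §3.1 p. 19] -/
theorem isConj_map_ringEquiv_iff (g d : GL n R) :
    IsConj (Matrix.GeneralLinearGroup.map (Φ : R →+* R') g) (Matrix.GeneralLinearGroup.map (Φ : R →+* R') d) ↔ IsConj g d := by
  refine ⟨fun h => ?_, fun h => (Matrix.GeneralLinearGroup.map (Φ : R →+* R')).map_isConj h⟩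
  have h' := (Matrix.GeneralLinearGroup.map (Φ.symm : R' →+* R)).map_isConj h
  rwa [map_ringEquiv_symm_map, map_ringEquiv_symm_map] at h'

/-- **Regularity (separable characteristic polynomial, ★ `IsRegularElt`) is invariant under a ring isomorphism applied entrywise** (Mathlib `Matrix.charpoly_map`;
`Polynomial.Separable.map` both ways along `Φ` and `Φ⁻¹`). [cite: Rogawski1990, §4.3 p. 42] -/
theorem isRegularElt_map_ringEquiv_iff (g : GL n R) :
    IsRegularElt (Matrix.GeneralLinearGroup.map (Φ : R →+* R') g) ↔ IsRegularElt g := by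
  rw [isRegularElt_iff, isRegularElt_iff]
  have hm : ((Matrix.GeneralLinearGroup.map (Φ : R →+* R') g : GL n R') : Matrix n n R') = (g : Matrix n n R).map (Φ : R →+* R') := rfl
  rw [hm, Matrix.charpoly_map]
  refine ⟨fun h => ?_, fun h => h.map⟩
  have h' := h.map (f := (Φ.symm : R' →+* R))
  rwa [Polynomial.map_map, show (Φ.symm : R' →+* R).comp (Φ : R →+* R') = RingHom.id R from RingHom.ext fun x => Φ.symm_apply_apply x,
    Polynomial.map_id] at h'

end GLRingEquiv

/-! ## §3 The socket's bytes: `Δ‴`-matching transports along `(Φ, e₃, e₂, e₁, e_H)` (modulo G1) -/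

section CM

variable (L : Type) [Field L] [NumberField L] [IsCMField L] (H' : Matrix (Fin 3) (Fin 3) L)
  (v : HeightOneSpectrum (𝓞 ↥(maximalRealSubfield L)))

/-- **`ι` commutes with the ground-field change on matrices**: `ι(e_H γ_H) = Φ·ι(γ_H)` entrywise, because `ι(g₂, g₁) = (a 0 b; 0 u 0; c 0 d)` (★ `coe_coe_endoEmb_eq`) and
`e₂, e₁` act entrywise by `Φ`. [cite: Rogawski1990, §4.8 Case (a) p. 53] -/
theorem coe_endoEmb_transport
    (L' : Type) [Field L'] [NumberField L'] [IsCMField L'] (v' : HeightOneSpectrum (𝓞 ↥(maximalRealSubfield L')))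
    (Φ : UnitaryGroup.LocalRing L v ≃+* UnitaryGroup.LocalRing L' v')
    (e₂ : (UnitaryGroup.cmDatum L 2 (Matrix.of fun i j : Fin 2 => if i.val + j.val + 1 = 2 then (1 : L) else 0)).Local v ≃ₜ*
      (UnitaryGroup.cmDatum L' 2 (Matrix.of fun i j : Fin 2 => if i.val + j.val + 1 = 2 then (1 : L') else 0)).Local v')
    (he₂ : ∀ g, ((e₂ g).val : GL (Fin 2) (UnitaryGroup.LocalRing L' v')) = Matrix.GeneralLinearGroup.map (Φ : UnitaryGroup.LocalRing L v →+* UnitaryGroup.LocalRing L' v') (g.val : GL (Fin 2) (UnitaryGroup.LocalRing L v)))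
    (e₁ : (UnitaryGroup.cmDatum L 1 (Matrix.of fun i j : Fin 1 => if i.val + j.val + 1 = 1 then (1 : L) else 0)).Local v ≃ₜ*
      (UnitaryGroup.cmDatum L' 1 (Matrix.of fun i j : Fin 1 => if i.val + j.val + 1 = 1 then (1 : L') else 0)).Local v')
    (he₁ : ∀ g, ((e₁ g).val : GL (Fin 1) (UnitaryGroup.LocalRing L' v')) = Matrix.GeneralLinearGroup.map (Φ : UnitaryGroup.LocalRing L v →+* UnitaryGroup.LocalRing L' v') (g.val : GL (Fin 1) (UnitaryGroup.LocalRing L v)))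
    (eH : ((UnitaryGroup.cmDatum L 2 (Matrix.of fun i j : Fin 2 => if i.val + j.val + 1 = 2 then (1 : L) else 0)).Local v ×
      (UnitaryGroup.cmDatum L 1 (Matrix.of fun i j : Fin 1 => if i.val + j.val + 1 = 1 then (1 : L) else 0)).Local v) ≃ₜ*
      ((UnitaryGroup.cmDatum L' 2 (Matrix.of fun i j : Fin 2 => if i.val + j.val + 1 = 2 then (1 : L') else 0)).Local v' ×
      (UnitaryGroup.cmDatum L' 1 (Matrix.of fun i j : Fin 1 => if i.val + j.val + 1 = 1 then (1 : L') else 0)).Local v'))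
    (heH : ∀ h, eH h = (e₂ h.1, e₁ h.2))
    (γH : ((UnitaryGroup.cmDatum L 2 (Matrix.of fun i j : Fin 2 => if i.val + j.val + 1 = 2 then (1 : L) else 0)).Local v ×
      (UnitaryGroup.cmDatum L 1 (Matrix.of fun i j : Fin 1 => if i.val + j.val + 1 = 1 then (1 : L) else 0)).Local v)) :
    ((endoEmb (conjLocal L' (IsCMField.complexConj L') v') _ _ _ (endoForm_localForm L' v') (eH γH) :
        unitaryGroupOfForm (conjLocal L' (IsCMField.complexConj L') v')
          ((UnitaryGroup.adelicForm L' 3 (Matrix.of fun i j : Fin 3 => if i.val + j.val + 1 = 3 then (1 : L') else 0)).map (UnitaryGroup.adeleToLocal L' v'))) :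
        GL (Fin 3) (UnitaryGroup.LocalRing L' v')) =
      Matrix.GeneralLinearGroup.map (Φ : UnitaryGroup.LocalRing L v →+* UnitaryGroup.LocalRing L' v')
        ((endoEmb (conjLocal L (IsCMField.complexConj L) v) _ _ _ (endoForm_localForm L v) γH :
          unitaryGroupOfForm (conjLocal L (IsCMField.complexConj L) v)
            ((UnitaryGroup.adelicForm L 3 (Matrix.of fun i j : Fin 3 => if i.val + j.val + 1 = 3 then (1 : L) else 0)).map (UnitaryGroup.adeleToLocal L v))) :
          GL (Fin 3) (UnitaryGroup.LocalRing L v)) := by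
  have h2 : ∀ i j, ((eH γH).1.val : GL (Fin 2) (UnitaryGroup.LocalRing L' v')) i j = Φ ((γH.1.val : GL (Fin 2) (UnitaryGroup.LocalRing L v)) i j) := fun i j => by
    rw [heH]
    dsimp only
    rw [he₂, Matrix.GeneralLinearGroup.map_apply, RingHom.coe_coe]
  have h1 : ∀ i j, ((eH γH).2.val : GL (Fin 1) (UnitaryGroup.LocalRing L' v')) i j = Φ ((γH.2.val : GL (Fin 1) (UnitaryGroup.LocalRing L v)) i j) := fun i j => by
    rw [heH]
    dsimp only
    rw [he₁, Matrix.GeneralLinearGroup.map_apply, RingHom.coe_coe]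
  refine Matrix.GeneralLinearGroup.ext fun i j => ?_
  rw [Matrix.GeneralLinearGroup.map_apply, RingHom.coe_coe, coe_coe_endoEmb_eq, coe_coe_endoEmb_eq]
  fin_cases i <;> fin_cases j <;> simp [h2, h1, map_zero]

/-- **`G`-regularity of `γ_H` is invariant under the ground-field change** (`IsLocalGRegular` = separability of the characteristic polynomial of `ι(γ_H)`; `coe_endoEmb_transport`
+ `isRegularElt_map_ringEquiv_iff`). [cite: Rogawski1990, §4.3 p. 42] -/
theorem isLocalGRegular_transport_iff
    (L' : Type) [Field L'] [NumberField L'] [IsCMField L'] (v' : HeightOneSpectrum (𝓞 ↥(maximalRealSubfield L')))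
    (Φ : UnitaryGroup.LocalRing L v ≃+* UnitaryGroup.LocalRing L' v')
    (e₂ : (UnitaryGroup.cmDatum L 2 (Matrix.of fun i j : Fin 2 => if i.val + j.val + 1 = 2 then (1 : L) else 0)).Local v ≃ₜ*
      (UnitaryGroup.cmDatum L' 2 (Matrix.of fun i j : Fin 2 => if i.val + j.val + 1 = 2 then (1 : L') else 0)).Local v')
    (he₂ : ∀ g, ((e₂ g).val : GL (Fin 2) (UnitaryGroup.LocalRing L' v')) = Matrix.GeneralLinearGroup.map (Φ : UnitaryGroup.LocalRing L v →+* UnitaryGroup.LocalRing L' v') (g.val : GL (Fin 2) (UnitaryGroup.LocalRing L v)))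
    (e₁ : (UnitaryGroup.cmDatum L 1 (Matrix.of fun i j : Fin 1 => if i.val + j.val + 1 = 1 then (1 : L) else 0)).Local v ≃ₜ*
      (UnitaryGroup.cmDatum L' 1 (Matrix.of fun i j : Fin 1 => if i.val + j.val + 1 = 1 then (1 : L') else 0)).Local v')
    (he₁ : ∀ g, ((e₁ g).val : GL (Fin 1) (UnitaryGroup.LocalRing L' v')) = Matrix.GeneralLinearGroup.map (Φ : UnitaryGroup.LocalRing L v →+* UnitaryGroup.LocalRing L' v') (g.val : GL (Fin 1) (UnitaryGroup.LocalRing L v)))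
    (eH : ((UnitaryGroup.cmDatum L 2 (Matrix.of fun i j : Fin 2 => if i.val + j.val + 1 = 2 then (1 : L) else 0)).Local v ×
      (UnitaryGroup.cmDatum L 1 (Matrix.of fun i j : Fin 1 => if i.val + j.val + 1 = 1 then (1 : L) else 0)).Local v) ≃ₜ*
      ((UnitaryGroup.cmDatum L' 2 (Matrix.of fun i j : Fin 2 => if i.val + j.val + 1 = 2 then (1 : L') else 0)).Local v' ×
      (UnitaryGroup.cmDatum L' 1 (Matrix.of fun i j : Fin 1 => if i.val + j.val + 1 = 1 then (1 : L') else 0)).Local v'))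
    (heH : ∀ h, eH h = (e₂ h.1, e₁ h.2))
    (γH : ((UnitaryGroup.cmDatum L 2 (Matrix.of fun i j : Fin 2 => if i.val + j.val + 1 = 2 then (1 : L) else 0)).Local v ×
      (UnitaryGroup.cmDatum L 1 (Matrix.of fun i j : Fin 1 => if i.val + j.val + 1 = 1 then (1 : L) else 0)).Local v)) :
    IsLocalGRegular L' v' (eH γH) ↔ IsLocalGRegular L v γH := by
  unfold IsLocalGRegular IsGRegular
  rw [coe_endoEmb_transport L v L' v' Φ e₂ he₂ e₁ he₁ eH heH γH]
  exact isRegularElt_map_ringEquiv_iff Φ _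

/-- **Stable conjugacy in `H_v` is invariant under the ground-field change** (componentwise `GL`-conjugacy, `isConj_map_ringEquiv_iff`). [cite: Rogawski1990, §3.1 p. 19] -/
theorem isLocalStablyConjH_transport_iff
    (L' : Type) [Field L'] [NumberField L'] [IsCMField L'] (v' : HeightOneSpectrum (𝓞 ↥(maximalRealSubfield L')))
    (Φ : UnitaryGroup.LocalRing L v ≃+* UnitaryGroup.LocalRing L' v')
    (e₂ : (UnitaryGroup.cmDatum L 2 (Matrix.of fun i j : Fin 2 => if i.val + j.val + 1 = 2 then (1 : L) else 0)).Local v ≃ₜ*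
      (UnitaryGroup.cmDatum L' 2 (Matrix.of fun i j : Fin 2 => if i.val + j.val + 1 = 2 then (1 : L') else 0)).Local v')
    (he₂ : ∀ g, ((e₂ g).val : GL (Fin 2) (UnitaryGroup.LocalRing L' v')) = Matrix.GeneralLinearGroup.map (Φ : UnitaryGroup.LocalRing L v →+* UnitaryGroup.LocalRing L' v') (g.val : GL (Fin 2) (UnitaryGroup.LocalRing L v)))
    (e₁ : (UnitaryGroup.cmDatum L 1 (Matrix.of fun i j : Fin 1 => if i.val + j.val + 1 = 1 then (1 : L) else 0)).Local v ≃ₜ*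
      (UnitaryGroup.cmDatum L' 1 (Matrix.of fun i j : Fin 1 => if i.val + j.val + 1 = 1 then (1 : L') else 0)).Local v')
    (he₁ : ∀ g, ((e₁ g).val : GL (Fin 1) (UnitaryGroup.LocalRing L' v')) = Matrix.GeneralLinearGroup.map (Φ : UnitaryGroup.LocalRing L v →+* UnitaryGroup.LocalRing L' v') (g.val : GL (Fin 1) (UnitaryGroup.LocalRing L v)))
    (eH : ((UnitaryGroup.cmDatum L 2 (Matrix.of fun i j : Fin 2 => if i.val + j.val + 1 = 2 then (1 : L) else 0)).Local v ×
      (UnitaryGroup.cmDatum L 1 (Matrix.of fun i j : Fin 1 => if i.val + j.val + 1 = 1 then (1 : L) else 0)).Local v) ≃ₜ*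
      ((UnitaryGroup.cmDatum L' 2 (Matrix.of fun i j : Fin 2 => if i.val + j.val + 1 = 2 then (1 : L') else 0)).Local v' ×
      (UnitaryGroup.cmDatum L' 1 (Matrix.of fun i j : Fin 1 => if i.val + j.val + 1 = 1 then (1 : L') else 0)).Local v'))
    (heH : ∀ h, eH h = (e₂ h.1, e₁ h.2))
    (a a₂ : ((UnitaryGroup.cmDatum L 2 (Matrix.of fun i j : Fin 2 => if i.val + j.val + 1 = 2 then (1 : L) else 0)).Local v ×
      (UnitaryGroup.cmDatum L 1 (Matrix.of fun i j : Fin 1 => if i.val + j.val + 1 = 1 then (1 : L) else 0)).Local v)) :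
    IsLocalStablyConjH L v a a₂ ↔ IsLocalStablyConjH L' v' (eH a) (eH a₂) := by
  have h₂ : IsConj (a.1.val : GL (Fin 2) (UnitaryGroup.LocalRing L v)) (a₂.1.val : GL (Fin 2) (UnitaryGroup.LocalRing L v)) ↔
      IsConj ((e₂ a.1).val : GL (Fin 2) (UnitaryGroup.LocalRing L' v')) ((e₂ a₂.1).val : GL (Fin 2) (UnitaryGroup.LocalRing L' v')) := by
    rw [he₂ a.1, he₂ a₂.1]
    exact (isConj_map_ringEquiv_iff Φ _ _).symm
  have h₁ : IsConj (a.2.val : GL (Fin 1) (UnitaryGroup.LocalRing L v)) (a₂.2.val : GL (Fin 1) (UnitaryGroup.LocalRing L v)) ↔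
      IsConj ((e₁ a.2).val : GL (Fin 1) (UnitaryGroup.LocalRing L' v')) ((e₁ a₂.2).val : GL (Fin 1) (UnitaryGroup.LocalRing L' v')) := by
    rw [he₁ a.2, he₁ a₂.2]
    exact (isConj_map_ringEquiv_iff Φ _ _).symm
  unfold IsLocalStablyConjH IsStablyConjH IsStablyConj
  rw [heH a, heH a₂]
  exact and_congr h₂ h₁

/-- Stable conjugacy in `H_v` is a class function in the second variable (conjugate ⇒ stably conjugate, ★ `isStablyConjH_of_isConj`). [cite: Rogawski1990, §3.1 p. 19] -/
theorem isLocalStablyConjH_congr_of_isConj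
    (a y y' : ((UnitaryGroup.cmDatum L 2 (Matrix.of fun i j : Fin 2 => if i.val + j.val + 1 = 2 then (1 : L) else 0)).Local v ×
      (UnitaryGroup.cmDatum L 1 (Matrix.of fun i j : Fin 1 => if i.val + j.val + 1 = 1 then (1 : L) else 0)).Local v)) (h : IsConj y y') :
    IsLocalStablyConjH L v a y ↔ IsLocalStablyConjH L v a y' :=
  ⟨fun h1 => IsStablyConjH.trans h1 (isStablyConjH_of_isConj h), fun h2 => IsStablyConjH.trans h2 (isStablyConjH_of_isConj h).symm⟩

/-- **DEAL S3-p18 = BRICK G2 — `Δ‴`-MATCHING TRANSPORTS ALONG THE GROUND-FIELD CHANGE, modulo G1.**  Binders = socket `stub_R90_S3_transport_deltaTransfer` VERBATIM (currency `(L′, v′, Φ,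
hc, hc′, hΦσ)`, exact form pair `(H″, hΦH)`, characters `(μ, μ′, hΦμ)`, isomorphisms `e₃ he₃ e₂ he₂ e₁ he₁ eH heH`, the 16 measurable∕Borel instance binders, `mH mG fH f`) with ONE
addition right after `heH`: `hΔ : ∀ γH γ, Δ‴_{v′}(e_H γ_H, e₃ γ; H″, μ′) = Δ‴_v(γ_H, γ; H′, μ)` (= G1's conclusion).  Conclusion = the socket's `IsLocalDeltaTransfer … ↔ …` BYTES.  Proof:
§1 `isDeltaTransferRel_transport_iff` at `ψ_A := eH`, `ψ_B := e₃`, with §3's `isLocalStablyConjH_transport_iff` ∕ `_congr_of_isConj` ∕ `isLocalGRegular_transport_iff` and `hΔ` through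
★ `finExplicitCollection_Δ`. [cite: Rogawski1990, §4.3 (4.3.1) p. 43; §14.2 (14.2.1) p. 232; §4.9 p. 55] [cite: Gelbart1975, §10 pp. 154–155] -/
theorem isLocalDeltaTransfer_transport_iff_of_delta
    (L' : Type) [Field L'] [NumberField L'] [IsCMField L'] (v' : HeightOneSpectrum (𝓞 ↥(maximalRealSubfield L')))
    (Φ : UnitaryGroup.LocalRing L v ≃+* UnitaryGroup.LocalRing L' v') (_hc : Continuous Φ) (_hc' : Continuous Φ.symm)
    (_hΦσ : ∀ x, Φ ((conjLocal L (IsCMField.complexConj L) v) x) = (conjLocal L' (IsCMField.complexConj L') v') (Φ x))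
    (H'' : Matrix (Fin 3) (Fin 3) L')
    (_hΦH : (H'.map (algebraMap L (UnitaryGroup.LocalRing L v))).map Φ = H''.map (algebraMap L' (UnitaryGroup.LocalRing L' v')))
    (μ : HeckeCharacter L) (μ' : HeckeCharacter L')
    (_hΦμ : ∀ u : (UnitaryGroup.LocalRing L v)ˣ,
      μ'.semilocalComponent L' v' (Units.map (Φ : UnitaryGroup.LocalRing L v →+* UnitaryGroup.LocalRing L' v').toMonoidHom u) = μ.semilocalComponent L v u)
    (e₃ : (UnitaryGroup.cmDatum L 3 H').Local v ≃ₜ* (UnitaryGroup.cmDatum L' 3 H'').Local v')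
    (_he₃ : ∀ g, ((e₃ g).val : GL (Fin 3) (UnitaryGroup.LocalRing L' v')) = Matrix.GeneralLinearGroup.map (Φ : UnitaryGroup.LocalRing L v →+* UnitaryGroup.LocalRing L' v') (g.val : GL (Fin 3) (UnitaryGroup.LocalRing L v)))
    (e₂ : (UnitaryGroup.cmDatum L 2 (Matrix.of fun i j : Fin 2 => if i.val + j.val + 1 = 2 then (1 : L) else 0)).Local v ≃ₜ*
      (UnitaryGroup.cmDatum L' 2 (Matrix.of fun i j : Fin 2 => if i.val + j.val + 1 = 2 then (1 : L') else 0)).Local v')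
    (he₂ : ∀ g, ((e₂ g).val : GL (Fin 2) (UnitaryGroup.LocalRing L' v')) = Matrix.GeneralLinearGroup.map (Φ : UnitaryGroup.LocalRing L v →+* UnitaryGroup.LocalRing L' v') (g.val : GL (Fin 2) (UnitaryGroup.LocalRing L v)))
    (e₁ : (UnitaryGroup.cmDatum L 1 (Matrix.of fun i j : Fin 1 => if i.val + j.val + 1 = 1 then (1 : L) else 0)).Local v ≃ₜ*
      (UnitaryGroup.cmDatum L' 1 (Matrix.of fun i j : Fin 1 => if i.val + j.val + 1 = 1 then (1 : L') else 0)).Local v')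
    (he₁ : ∀ g, ((e₁ g).val : GL (Fin 1) (UnitaryGroup.LocalRing L' v')) = Matrix.GeneralLinearGroup.map (Φ : UnitaryGroup.LocalRing L v →+* UnitaryGroup.LocalRing L' v') (g.val : GL (Fin 1) (UnitaryGroup.LocalRing L v)))
    (eH : ((UnitaryGroup.cmDatum L 2 (Matrix.of fun i j : Fin 2 => if i.val + j.val + 1 = 2 then (1 : L) else 0)).Local v ×
      (UnitaryGroup.cmDatum L 1 (Matrix.of fun i j : Fin 1 => if i.val + j.val + 1 = 1 then (1 : L) else 0)).Local v) ≃ₜ*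
      ((UnitaryGroup.cmDatum L' 2 (Matrix.of fun i j : Fin 2 => if i.val + j.val + 1 = 2 then (1 : L') else 0)).Local v' ×
      (UnitaryGroup.cmDatum L' 1 (Matrix.of fun i j : Fin 1 => if i.val + j.val + 1 = 1 then (1 : L') else 0)).Local v'))
    (heH : ∀ h, eH h = (e₂ h.1, e₁ h.2))
    -- G1's conclusion (socket `stub_R90_S3_transport_delta`), HYPOTHESIS-FIRST
    (hΔ : ∀ (γH : ((UnitaryGroup.cmDatum L 2 (Matrix.of fun i j : Fin 2 => if i.val + j.val + 1 = 2 then (1 : L) else 0)).Local v ×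
        (UnitaryGroup.cmDatum L 1 (Matrix.of fun i j : Fin 1 => if i.val + j.val + 1 = 1 then (1 : L) else 0)).Local v))
      (γ : (UnitaryGroup.cmDatum L 3 H').Local v), finExplicitDelta L' v' H'' (eH γH) μ' (e₃ γ) = finExplicitDelta L v H' γH μ γ)
    [MeasurableSpace ((UnitaryGroup.cmDatum L 3 H').Local v)] [BorelSpace ((UnitaryGroup.cmDatum L 3 H').Local v)]
    [∀ γ : ((UnitaryGroup.cmDatum L 3 H').Local v), MeasurableSpace (((UnitaryGroup.cmDatum L 3 H').Local v) ⧸ Subgroup.centralizer ({γ} : Set ((UnitaryGroup.cmDatum L 3 H').Local v)))]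
    [∀ γ : ((UnitaryGroup.cmDatum L 3 H').Local v), BorelSpace (((UnitaryGroup.cmDatum L 3 H').Local v) ⧸ Subgroup.centralizer ({γ} : Set ((UnitaryGroup.cmDatum L 3 H').Local v)))]
    [MeasurableSpace ((UnitaryGroup.cmDatum L 2 (Matrix.of fun i j : Fin 2 => if i.val + j.val + 1 = 2 then (1 : L) else 0)).Local v ×
      (UnitaryGroup.cmDatum L 1 (Matrix.of fun i j : Fin 1 => if i.val + j.val + 1 = 1 then (1 : L) else 0)).Local v)] [BorelSpace ((UnitaryGroup.cmDatum L 2 (Matrix.of fun i j : Fin 2 => if i.val + j.val + 1 = 2 then (1 : L) else 0)).Local v ×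
      (UnitaryGroup.cmDatum L 1 (Matrix.of fun i j : Fin 1 => if i.val + j.val + 1 = 1 then (1 : L) else 0)).Local v)]
    [∀ a : ((UnitaryGroup.cmDatum L 2 (Matrix.of fun i j : Fin 2 => if i.val + j.val + 1 = 2 then (1 : L) else 0)).Local v ×
      (UnitaryGroup.cmDatum L 1 (Matrix.of fun i j : Fin 1 => if i.val + j.val + 1 = 1 then (1 : L) else 0)).Local v),
      MeasurableSpace (((UnitaryGroup.cmDatum L 2 (Matrix.of fun i j : Fin 2 => if i.val + j.val + 1 = 2 then (1 : L) else 0)).Local v ×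
      (UnitaryGroup.cmDatum L 1 (Matrix.of fun i j : Fin 1 => if i.val + j.val + 1 = 1 then (1 : L) else 0)).Local v) ⧸
        Subgroup.centralizer ({a} : Set ((UnitaryGroup.cmDatum L 2 (Matrix.of fun i j : Fin 2 => if i.val + j.val + 1 = 2 then (1 : L) else 0)).Local v ×
      (UnitaryGroup.cmDatum L 1 (Matrix.of fun i j : Fin 1 => if i.val + j.val + 1 = 1 then (1 : L) else 0)).Local v)))]
    [∀ a : ((UnitaryGroup.cmDatum L 2 (Matrix.of fun i j : Fin 2 => if i.val + j.val + 1 = 2 then (1 : L) else 0)).Local v ×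
      (UnitaryGroup.cmDatum L 1 (Matrix.of fun i j : Fin 1 => if i.val + j.val + 1 = 1 then (1 : L) else 0)).Local v),
      BorelSpace (((UnitaryGroup.cmDatum L 2 (Matrix.of fun i j : Fin 2 => if i.val + j.val + 1 = 2 then (1 : L) else 0)).Local v ×
      (UnitaryGroup.cmDatum L 1 (Matrix.of fun i j : Fin 1 => if i.val + j.val + 1 = 1 then (1 : L) else 0)).Local v) ⧸
        Subgroup.centralizer ({a} : Set ((UnitaryGroup.cmDatum L 2 (Matrix.of fun i j : Fin 2 => if i.val + j.val + 1 = 2 then (1 : L) else 0)).Local v ×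
      (UnitaryGroup.cmDatum L 1 (Matrix.of fun i j : Fin 1 => if i.val + j.val + 1 = 1 then (1 : L) else 0)).Local v)))]
    [MeasurableSpace ((UnitaryGroup.cmDatum L' 3 H'').Local v')] [BorelSpace ((UnitaryGroup.cmDatum L' 3 H'').Local v')]
    [∀ γ : ((UnitaryGroup.cmDatum L' 3 H'').Local v'), MeasurableSpace (((UnitaryGroup.cmDatum L' 3 H'').Local v') ⧸ Subgroup.centralizer ({γ} : Set ((UnitaryGroup.cmDatum L' 3 H'').Local v')))]
    [∀ γ : ((UnitaryGroup.cmDatum L' 3 H'').Local v'), BorelSpace (((UnitaryGroup.cmDatum L' 3 H'').Local v') ⧸ Subgroup.centralizer ({γ} : Set ((UnitaryGroup.cmDatum L' 3 H'').Local v')))]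
    [MeasurableSpace ((UnitaryGroup.cmDatum L' 2 (Matrix.of fun i j : Fin 2 => if i.val + j.val + 1 = 2 then (1 : L') else 0)).Local v' ×
      (UnitaryGroup.cmDatum L' 1 (Matrix.of fun i j : Fin 1 => if i.val + j.val + 1 = 1 then (1 : L') else 0)).Local v')] [BorelSpace ((UnitaryGroup.cmDatum L' 2 (Matrix.of fun i j : Fin 2 => if i.val + j.val + 1 = 2 then (1 : L') else 0)).Local v' ×
      (UnitaryGroup.cmDatum L' 1 (Matrix.of fun i j : Fin 1 => if i.val + j.val + 1 = 1 then (1 : L') else 0)).Local v')]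
    [∀ a : ((UnitaryGroup.cmDatum L' 2 (Matrix.of fun i j : Fin 2 => if i.val + j.val + 1 = 2 then (1 : L') else 0)).Local v' ×
      (UnitaryGroup.cmDatum L' 1 (Matrix.of fun i j : Fin 1 => if i.val + j.val + 1 = 1 then (1 : L') else 0)).Local v'),
      MeasurableSpace (((UnitaryGroup.cmDatum L' 2 (Matrix.of fun i j : Fin 2 => if i.val + j.val + 1 = 2 then (1 : L') else 0)).Local v' ×
      (UnitaryGroup.cmDatum L' 1 (Matrix.of fun i j : Fin 1 => if i.val + j.val + 1 = 1 then (1 : L') else 0)).Local v') ⧸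
        Subgroup.centralizer ({a} : Set ((UnitaryGroup.cmDatum L' 2 (Matrix.of fun i j : Fin 2 => if i.val + j.val + 1 = 2 then (1 : L') else 0)).Local v' ×
      (UnitaryGroup.cmDatum L' 1 (Matrix.of fun i j : Fin 1 => if i.val + j.val + 1 = 1 then (1 : L') else 0)).Local v')))]
    [∀ a : ((UnitaryGroup.cmDatum L' 2 (Matrix.of fun i j : Fin 2 => if i.val + j.val + 1 = 2 then (1 : L') else 0)).Local v' ×
      (UnitaryGroup.cmDatum L' 1 (Matrix.of fun i j : Fin 1 => if i.val + j.val + 1 = 1 then (1 : L') else 0)).Local v'),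
      BorelSpace (((UnitaryGroup.cmDatum L' 2 (Matrix.of fun i j : Fin 2 => if i.val + j.val + 1 = 2 then (1 : L') else 0)).Local v' ×
      (UnitaryGroup.cmDatum L' 1 (Matrix.of fun i j : Fin 1 => if i.val + j.val + 1 = 1 then (1 : L') else 0)).Local v') ⧸
        Subgroup.centralizer ({a} : Set ((UnitaryGroup.cmDatum L' 2 (Matrix.of fun i j : Fin 2 => if i.val + j.val + 1 = 2 then (1 : L') else 0)).Local v' ×
      (UnitaryGroup.cmDatum L' 1 (Matrix.of fun i j : Fin 1 => if i.val + j.val + 1 = 1 then (1 : L') else 0)).Local v')))]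
    (mH : OrbitalMeasureFamily ((UnitaryGroup.cmDatum L 2 (Matrix.of fun i j : Fin 2 => if i.val + j.val + 1 = 2 then (1 : L) else 0)).Local v ×
      (UnitaryGroup.cmDatum L 1 (Matrix.of fun i j : Fin 1 => if i.val + j.val + 1 = 1 then (1 : L) else 0)).Local v))
    (mG : OrbitalMeasureFamily ((UnitaryGroup.cmDatum L 3 H').Local v))
    (fH : ((UnitaryGroup.cmDatum L 2 (Matrix.of fun i j : Fin 2 => if i.val + j.val + 1 = 2 then (1 : L) else 0)).Local v ×
      (UnitaryGroup.cmDatum L 1 (Matrix.of fun i j : Fin 1 => if i.val + j.val + 1 = 1 then (1 : L) else 0)).Local v) → ℂ)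
    (f : (UnitaryGroup.cmDatum L 3 H').Local v → ℂ) :
    IsLocalDeltaTransfer L' H'' v' (finExplicitCollection L' H'' μ' (finExplicitDelta_conj_left_all L' H'' μ') (finExplicitDelta_conj_right_all L' H'' μ') v')
        (mH.transport eH.toMulEquiv eH.continuous eH.symm.continuous)
        (mG.transport e₃.toMulEquiv e₃.continuous e₃.symm.continuous) (fH ∘ eH.symm) (f ∘ e₃.symm) ↔
      IsLocalDeltaTransfer L H' v (finExplicitCollection L H' μ (finExplicitDelta_conj_left_all L H' μ) (finExplicitDelta_conj_right_all L H' μ) v) mH mG fH f :=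
  isDeltaTransferRel_transport_iff eH.toMulEquiv eH.continuous eH.symm.continuous e₃.toMulEquiv e₃.continuous e₃.symm.continuous
    (IsLocalStablyConjH L v) (IsLocalStablyConjH L' v') (IsLocalGRegular L v) (IsLocalGRegular L' v')
    (fun a a₂ => isLocalStablyConjH_transport_iff L v L' v' Φ e₂ he₂ e₁ he₁ eH heH a a₂)
    (fun a y y' h => isLocalStablyConjH_congr_of_isConj L v a y y' h)
    (fun a y y' h => isLocalStablyConjH_congr_of_isConj L' v' a y y' h)
    (fun γH => isLocalGRegular_transport_iff L v L' v' Φ e₂ he₂ e₁ he₁ eH heH γH)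
    _ _ (fun γH γ => by rw [finExplicitCollection_Δ, finExplicitCollection_Δ]; exact hΔ γH γ)
    mH mG fH f

end CM

end Summit.HodgeConjecture.HodgeConjecture.R90.S3

end
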